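import Literature.Barriers.Parity.SiegelZeroDichotomyPairHLSieveExpansion
import Literature.Barriers.Parity.SiegelZeroDichotomyChowlaStep3Flat
import Literature.NumberTheory.Sieve.SmoothMajorantCRT
import Mathlib.MeasureTheory.Integral.Pi
import HarnessLib

/-!
# Tao–Teräväinen 2022, Lemma 3.4 at `k = 2`: inserting the Fourier representation of `ψ_{≤R}`

Topic `Literature/Barriers/Parity`, sub-namespace `TaoTeravainen`; second file of the proof of
Tao–Teräväinen's Lemma 3.4 (arXiv:2109.06291, §3.2) at `k = 2`, `ℓ' = 0`, after
`SiegelZeroDichotomyPairHLSieveExpansion.lean` (the expansion `S = xΣ + O(R⁴)`,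
`Σ = ∑_{t ∈ E⁴} (∏ λ_{t_k}) 1_{(d*₀,d*₁)∣h₁-h₂}/[d*₀,d*₁]`). Everything here is PROVED.

The source: "We can expand the left-hand side using (3.16) and Fubini's theorem as
`∫_{ℝ^{2k}} ∑_{d'₁,d''₁,…} ∏ μ(d'_j)μ(d''_j) ∏ 1_{(d*_i,d*_j)∣h_i-h_j} /
([d*₁,…,d*_{k'}] ∏ (d'_j)^{(1+it'_j)/log R}(d''_j)^{(1+it''_j)/log R}) ∏ f(t'_j)f(t''_j) dt'_j dt''_j`
for some Schwartz function `f`." Here (3.16) is taken from the tree in the form already proved for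
the Chowla side (`SiegelZeroDichotomyChowlaStep3Cutoff.lean`, `…Step3Flat.lean`):
`ψ_{≤R}(e) = 1 - ∫ e^{s_t} f(t) dt`, `s_t = (1+2πit)/log R`, `f = cutoffFourier ψ 1` (the Fourier
transform of `u ↦ e^{-u}(1-ψ)(u)`, with decay to all orders), valid for every `e ≥ 1`.
[cite: TaoTeravainen2021, §3.2 (3.16) and proof of Lemma 3.4]

* `sievePrimes R` (the primes `< R`), `sieveTuples R` (4-tuples of squarefree numbers composed of
  primes `< R`, the tree's `CFZ.squarefreeOf`), `sieveMainSum_eq_sum_sieveTuples` — `Σ` may be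
  summed over `sieveTuples R` (the summand vanishes unless all slots are squarefree and `< R`);
* `cutoffLE_eq_one_sub_integral` — (3.16) for `ψ_{≤R}` as above;
* the padded slot weights (`padFn = 1_{[0,1]}`, a probability density put on the slots not carrying
  an oscillating factor, so that each of the `2⁴` terms of `∏_k (1 - ∫ t_k^{s} f)` is ONE integral
  over `ℝ⁴`; `slotWeight`, `padWeight = W_Y`, `slotPower = ∏_{k ∈ Y} t_k^{s_{τ_k}}`),
  the kernel `sieveKernel R h₁ h₂ d Y τ = K_Y(τ) = ∑_t (∏ μ(t_k)) crtDensity(d*₀,d*₁) ∏_{k∈Y} t_k^{s_{τ_k}}`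
  (the source's pointwise sum, for the slots `Y` that received the integral), and
* **`sieveMainSum_eq_sum_integral`** — `Σ = ∑_{Y ⊆ slots} (-1)^{|Y|} ∫_{ℝ⁴} K_Y(τ) W_Y(τ) dτ`
  (Fubini in the form of Mathlib's `integral_fintype_prod_volume_eq_prod`, and the exchange of the
  finite tuple sum with the integral).

The Euler product for `K_Y`, the pointwise bound and the integration are in the sequels.
-/

noncomputable section

open Finset MeasureTheory
open scoped ArithmeticFunction.Moebius

namespace Literature.Barriers.Parity

namespace TaoTeravainen

open Literature.NumberTheory.Sieve (CFZ.squarefreeOf CFZ.mem_squarefreeOf)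

/-! ### The primes below `R` and the squarefree tuples -/

/-- The primes `p < R` (all prime factors of the `e < R` in the support of `λ`). [cite: TaoTeravainen2021, §3.2 (proof of Lemma 3.4)] -/
def sievePrimes (R : ℝ) : Finset ℕ :=
  Nat.primesBelow ⌈R⌉₊

/-- Members of `sievePrimes` are prime. [folklore] -/
theorem prime_of_mem_sievePrimes {R : ℝ} {p : ℕ} (hp : p ∈ sievePrimes R) : p.Prime :=
  Nat.prime_of_mem_primesBelow hp

/-- Membership in `sievePrimes`. [folklore] -/
theorem mem_sievePrimes {R : ℝ} {p : ℕ} : p ∈ sievePrimes R ↔ (p : ℝ) < R ∧ p.Prime := by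
  rw [sievePrimes, Nat.mem_primesBelow, Nat.lt_ceil]

/-- The `4`-tuples of squarefree numbers composed of primes `< R` (the index set of the Euler
product). [cite: TaoTeravainen2021, §3.2 (proof of Lemma 3.4)] -/
def sieveTuples (R : ℝ) : Finset (Fin 4 → ℕ) :=
  Fintype.piFinset fun _ : Fin 4 => CFZ.squarefreeOf (sievePrimes R)

/-- A squarefree `1 ≤ e < R` is a squarefree number composed of primes `< R`. [folklore] -/
theorem mem_squarefreeOf_of_lt {R : ℝ} {e : ℕ} (heR : (e : ℝ) < R)
    (hsq : Squarefree e) : e ∈ CFZ.squarefreeOf (sievePrimes R) := by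
  rw [CFZ.mem_squarefreeOf fun p hp => prime_of_mem_sievePrimes hp]
  refine ⟨hsq, fun p hp => ?_⟩
  rw [mem_sievePrimes]
  have hpe : p ≤ e := Nat.le_of_mem_primeFactors hp
  exact ⟨lt_of_le_of_lt (by exact_mod_cast hpe) heR, Nat.prime_of_mem_primeFactors hp⟩

/-- **Switching the index set**: the main term may be summed over the squarefree tuples
composed of primes `< R` instead of `E⁴` (the weights `∏ λ_{t_k}` vanish unless every `t_k` is
squarefree, and `λ_e = 0` for `e ≥ R`). [cite: TaoTeravainen2021, §3.2 (proof of Lemma 3.4)] -/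
theorem sieveMainSum_eq_sum_sieveTuples {ψ : ℝ → ℝ} (hψ : IsSmoothCutoff ψ) {R : ℝ} (hR : 1 < R)
    (h₁ h₂ : ℕ) (d : Fin 2 → ℕ) :
    sieveMainSum ψ R h₁ h₂ d =
      ∑ t ∈ sieveTuples R,
        (∏ k, sieveWt ψ R (t k)) * crtDensity h₁ h₂ (tupleModulus d t 0) (tupleModulus d t 1) := by
  classical
  unfold sieveMainSum
  set F : (Fin 4 → ℕ) → ℝ := fun t =>
    (∏ k, sieveWt ψ R (t k)) * crtDensity h₁ h₂ (tupleModulus d t 0) (tupleModulus d t 1) with hF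
  -- both sums are the sum over the common subset `{t : ∀ k, t_k ∈ E, squarefree}`
  set S := (Fintype.piFinset fun _ : Fin 4 => sieveRange R).filter
    (fun t => ∀ k, Squarefree (t k)) with hS
  have hzero_of_not_sq : ∀ t : Fin 4 → ℕ, (¬ ∀ k, Squarefree (t k)) → F t = 0 := by
    intro t ht
    push Not at ht
    obtain ⟨k, hk⟩ := ht
    have : sieveWt ψ R (t k) = 0 := by
      rw [sieveWt, ArithmeticFunction.moebius_eq_zero_of_not_squarefree hk]
      simp
    rw [hF]
    simp only
    rw [Finset.prod_eq_zero (Finset.mem_univ k) this, zero_mul]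
  have hzero_of_ge : ∀ t : Fin 4 → ℕ, (∃ k, R ≤ (t k : ℝ)) → F t = 0 := by
    rintro t ⟨k, hk⟩
    rw [hF]
    simp only
    rw [Finset.prod_eq_zero (Finset.mem_univ k) (sieveWt_eq_zero_of_le hψ hR hk), zero_mul]
  have h1 : ∑ t ∈ Fintype.piFinset (fun _ : Fin 4 => sieveRange R), F t = ∑ t ∈ S, F t := by
    rw [hS, Finset.sum_filter_of_ne]
    intro t _ hne
    by_contra h
    exact hne (hzero_of_not_sq t h)
  have h2 : ∑ t ∈ sieveTuples R, F t = ∑ t ∈ S, F t := by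
    symm
    refine Finset.sum_subset ?_ ?_
    · intro t ht
      rw [hS, Finset.mem_filter, Fintype.mem_piFinset] at ht
      rw [sieveTuples, Fintype.mem_piFinset]
      intro k
      have hk := ht.1 k
      rw [mem_sieveRange] at hk
      exact mem_squarefreeOf_of_lt hk.2 (ht.2 k)
    · intro t ht hnot
      -- a squarefree tuple outside `S` has some `t k ≥ R`
      rw [sieveTuples, Fintype.mem_piFinset] at ht
      have hsq : ∀ k, Squarefree (t k) := fun k =>
        ((CFZ.mem_squarefreeOf fun p hp => prime_of_mem_sievePrimes hp).mp (ht k)).1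
      apply hzero_of_ge
      by_contra hlt
      push Not at hlt
      apply hnot
      rw [hS, Finset.mem_filter, Fintype.mem_piFinset]
      refine ⟨fun k => mem_sieveRange.mpr ⟨?_, hlt k⟩, hsq⟩
      exact Nat.pos_of_ne_zero (hsq k).ne_zero
  rw [h1, h2]

/-! ### The Fourier representation of `ψ_{≤R}` -/

/-- **(3.16) at `z = R`**: "`φ(log_z n) = ∫_ℝ n^{-(1+it)/log z} f(t) dt`" — here with the tree's
Fourier datum `f = cutoffFourier ψ 1` of the tail `1 - ψ` (so that `ψ_{≤R}(e) = 1 - ∫ e^{s_t} f(t) dt`,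
`s_t = (1 + 2πit)/log R`, from `one_sub_cutoff_eq_integral` at `D = R`).
[cite: TaoTeravainen2021, §3.2 (3.16)] -/
theorem cutoffLE_eq_one_sub_integral {ψ : ℝ → ℝ} (hψ : IsSmoothCutoff ψ) {R : ℝ} (hR : 1 < R)
    {e : ℕ} (he : e ≠ 0) :
    ((cutoffLE ψ R e : ℝ) : ℂ) = 1 - ∫ t : ℝ, (e : ℂ) ^ sParam R t * cutoffFourier ψ 1 t := by
  have h := one_sub_cutoff_eq_integral hψ hR le_rfl he
  rw [div_self (Real.log_pos hR).ne'] at h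
  unfold cutoffLE
  have : ((ψ (Real.log e / Real.log R) : ℝ) : ℂ) =
      1 - (((1 - ψ (Real.log e / Real.log R) : ℝ)) : ℂ) := by
    push_cast
    ring
  rw [this, h]

/-! ### The padded slot weights and the kernels `K_Y` -/

/-- The padding density `1_{[0,1]}` (a probability density used for the slots outside `Y`, so
that every term of the expansion is an integral over `ℝ⁴`). [folklore] -/
def padFn (t : ℝ) : ℝ :=
  Set.indicator (Set.Icc 0 1) (fun _ => (1 : ℝ)) t

/-- `1_{[0,1]} ≥ 0`. [folklore] -/
theorem padFn_nonneg (t : ℝ) : 0 ≤ padFn t := by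
  unfold padFn
  exact Set.indicator_nonneg (fun _ _ => zero_le_one) t

/-- `1_{[0,1]} ≤ 1`. [folklore] -/
theorem padFn_le_one (t : ℝ) : padFn t ≤ 1 := by
  unfold padFn
  exact Set.indicator_le_self' (fun _ _ => zero_le_one) t

/-- `1_{[0,1]}` is integrable. [folklore] -/
theorem integrable_padFn : Integrable padFn := by
  unfold padFn
  exact (integrable_indicator_iff measurableSet_Icc).mpr continuous_const.integrableOn_Icc

/-- `∫ 1_{[0,1]} = 1`. [folklore] -/
theorem integral_padFn : ∫ t, padFn t = 1 := by
  unfold padFn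
  rw [integral_indicator measurableSet_Icc, setIntegral_const, smul_eq_mul, mul_one,
    measureReal_def, Real.volume_Icc, ENNReal.toReal_ofReal (by norm_num)]
  norm_num

/-- The slot weight: `e^{s_t} f(t)` on the slots `k ∈ Y`, the padding density elsewhere.
[cite: TaoTeravainen2021, §3.2 (proof of Lemma 3.4: "We can expand the left-hand side using (3.16) and Fubini's theorem")] -/
def slotWeight (ψ : ℝ → ℝ) (R : ℝ) (Y : Finset (Fin 4)) (k : Fin 4) (e : ℕ) (t : ℝ) : ℂ :=
  if k ∈ Y then (e : ℂ) ^ sParam R t * cutoffFourier ψ 1 t else ((padFn t : ℝ) : ℂ)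

/-- The weight `W_Y(τ) = ∏_{k ∈ Y} f(τ_k) ∏_{k ∉ Y} 1_{[0,1]}(τ_k)`. [folklore] -/
def padWeight (ψ : ℝ → ℝ) (Y : Finset (Fin 4)) (τ : Fin 4 → ℝ) : ℂ :=
  ∏ k, (if k ∈ Y then cutoffFourier ψ 1 (τ k) else ((padFn (τ k) : ℝ) : ℂ))

/-- The oscillating factor `∏_{k ∈ Y} t_k^{s_{τ_k}}`. [cite: TaoTeravainen2021, §3.2 (proof of Lemma 3.4)] -/
def slotPower (R : ℝ) (Y : Finset (Fin 4)) (t : Fin 4 → ℕ) (τ : Fin 4 → ℝ) : ℂ :=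
  ∏ k ∈ Y, ((t k : ℂ) ^ sParam R (τ k))

/-- The slot weights factor as `slotPower · padWeight`. [folklore] -/
theorem prod_slotWeight_eq (ψ : ℝ → ℝ) (R : ℝ) (Y : Finset (Fin 4)) (t : Fin 4 → ℕ)
    (τ : Fin 4 → ℝ) :
    ∏ k, slotWeight ψ R Y k (t k) (τ k) = slotPower R Y t τ * padWeight ψ Y τ := by
  classical
  unfold slotWeight slotPower padWeight
  rw [← Finset.prod_filter_mul_prod_filter_not Finset.univ (fun k => k ∈ Y)]
  rw [← Finset.prod_filter_mul_prod_filter_not Finset.univ (fun k => k ∈ Y)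
    (f := fun k => if k ∈ Y then cutoffFourier ψ 1 (τ k) else ((padFn (τ k) : ℝ) : ℂ))]
  have hY : Finset.univ.filter (fun k : Fin 4 => k ∈ Y) = Y := by
    ext k
    simp
  rw [hY]
  have e1 : ∏ k ∈ Y, (if k ∈ Y then (t k : ℂ) ^ sParam R (τ k) * cutoffFourier ψ 1 (τ k)
      else ((padFn (τ k) : ℝ) : ℂ)) =
      (∏ k ∈ Y, ((t k : ℂ) ^ sParam R (τ k))) * ∏ k ∈ Y, cutoffFourier ψ 1 (τ k) := by
    rw [← Finset.prod_mul_distrib]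
    exact Finset.prod_congr rfl fun k hk => by rw [if_pos hk]
  have e2 : ∏ k ∈ Y, (if k ∈ Y then cutoffFourier ψ 1 (τ k) else ((padFn (τ k) : ℝ) : ℂ)) =
      ∏ k ∈ Y, cutoffFourier ψ 1 (τ k) :=
    Finset.prod_congr rfl fun k hk => by rw [if_pos hk]
  have e3 : ∏ k ∈ Finset.univ.filter (fun k : Fin 4 => ¬ k ∈ Y),
      (if k ∈ Y then (t k : ℂ) ^ sParam R (τ k) * cutoffFourier ψ 1 (τ k)
        else ((padFn (τ k) : ℝ) : ℂ)) =
      ∏ k ∈ Finset.univ.filter (fun k : Fin 4 => ¬ k ∈ Y),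
        (if k ∈ Y then cutoffFourier ψ 1 (τ k) else ((padFn (τ k) : ℝ) : ℂ)) :=
    Finset.prod_congr rfl fun k hk => by
      rw [Finset.mem_filter] at hk
      rw [if_neg hk.2, if_neg hk.2]
  rw [e1, e2, e3]
  ring

/-- **The kernel `K_Y(τ)`**: the tuple sum with the Möbius signs, the density
`1_{(d*₀,d*₁)∣h₁-h₂}/[d*₀,d*₁]` and the oscillating factor `∏_{k ∈ Y} t_k^{s_{τ_k}}` ("it will
suffice to establish the pointwise bound `∑ ∏ μ(d'_j)μ(d''_j) ∏ 1_{(d*_i,d*_j)∣h_i-h_j} /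
([d*₁,…] ∏ (d'_j)^{(1+it'_j)/log R} (d''_j)^{(1+it''_j)/log R}) ≪ …` for all `t'₁, …, t''_k ∈ ℝ`").
[cite: TaoTeravainen2021, §3.2 (proof of Lemma 3.4, the pointwise bound)] -/
def sieveKernel (R : ℝ) (h₁ h₂ : ℕ) (d : Fin 2 → ℕ) (Y : Finset (Fin 4)) (τ : Fin 4 → ℝ) : ℂ :=
  ∑ t ∈ sieveTuples R,
    (((∏ k, (μ (t k) : ℝ)) * crtDensity h₁ h₂ (tupleModulus d t 0) (tupleModulus d t 1) : ℝ) : ℂ) *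
      slotPower R Y t τ

/-! ### Integrability of the slot weights -/

/-- `‖e^{s_t}‖ = e^{1/log R}` (for the natural number `e ≥ 1`): constant in `t`. [folklore] -/
theorem norm_natCast_cpow_sParam {e : ℕ} (he : e ≠ 0) (R t : ℝ) :
    ‖(e : ℂ) ^ sParam R t‖ = (e : ℝ) ^ (1 / Real.log R) := by
  rw [norm_natCast_cpow_of_ne_zero he, sParam_re]

/-- Each slot weight is integrable in its variable. [folklore] -/
theorem integrable_slotWeight {ψ : ℝ → ℝ} (hψ : IsSmoothCutoff ψ) (R : ℝ) (Y : Finset (Fin 4))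
    (k : Fin 4) {e : ℕ} (he : e ≠ 0) : Integrable (slotWeight ψ R Y k e) := by
  unfold slotWeight
  by_cases hk : k ∈ Y
  · simp only [if_pos hk]
    refine Integrable.bdd_mul (c := (e : ℝ) ^ (1 / Real.log R))
      (hψ.integrable_cutoffFourier one_pos le_rfl)
      (continuous_natCast_cpow_sParam he R).aestronglyMeasurable ?_
    filter_upwards with t
    rw [norm_natCast_cpow_sParam he]
  · simp only [if_neg hk]
    exact integrable_padFn.ofReal

/-- `∫ slotWeight = ∫ e^{s_t} f(t) dt` on `Y` and `= 1` off `Y`. [folklore] -/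
theorem integral_slotWeight (ψ : ℝ → ℝ) (R : ℝ) (Y : Finset (Fin 4)) (k : Fin 4) (e : ℕ) :
    ∫ t, slotWeight ψ R Y k e t =
      if k ∈ Y then ∫ t : ℝ, (e : ℂ) ^ sParam R t * cutoffFourier ψ 1 t else 1 := by
  unfold slotWeight
  by_cases hk : k ∈ Y
  · simp only [if_pos hk]
  · simp only [if_neg hk]
    rw [integral_complex_ofReal, integral_padFn]
    simp

/-! ### The sixteen-term expansion of the main term -/

/-- **The main term as a sum of `ℝ⁴`-integrals**: for `d₀, d₁ ≥ 1` and `R > 1`,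
`Σ(d₀,d₁) = ∑_{Y ⊆ slots} (-1)^{|Y|} ∫_{ℝ⁴} K_Y(τ) W_Y(τ) dτ` (insert `ψ_{≤R}(e) = 1 - ∫ e^{s_t} f`
in each of the four slots, expand the product, and use Fubini for the finitely many tuples).
[cite: TaoTeravainen2021, §3.2 (proof of Lemma 3.4: "We can expand the left-hand side using (3.16) and Fubini's theorem")] -/
theorem sieveMainSum_eq_sum_integral {ψ : ℝ → ℝ} (hψ : IsSmoothCutoff ψ) {R : ℝ} (hR : 1 < R)
    (h₁ h₂ : ℕ) (d : Fin 2 → ℕ) :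
    ((sieveMainSum ψ R h₁ h₂ d : ℝ) : ℂ) =
      ∑ Y ∈ (Finset.univ : Finset (Fin 4)).powerset,
        (-1) ^ #Y * ∫ τ : Fin 4 → ℝ, sieveKernel R h₁ h₂ d Y τ * padWeight ψ Y τ := by
  classical
  rw [sieveMainSum_eq_sum_sieveTuples hψ hR h₁ h₂ d]
  push_cast
  -- abbreviations
  set T := sieveTuples R with hT
  set I : ℕ → ℂ := fun e => ∫ t : ℝ, (e : ℂ) ^ sParam R t * cutoffFourier ψ 1 t with hI
  set c : (Fin 4 → ℕ) → ℝ := fun t =>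
    (∏ k, (μ (t k) : ℝ)) * crtDensity h₁ h₂ (tupleModulus d t 0) (tupleModulus d t 1) with hc
  have hTpos : ∀ t ∈ T, ∀ k, t k ≠ 0 := by
    intro t ht k
    rw [hT, sieveTuples, Fintype.mem_piFinset] at ht
    exact ((CFZ.mem_squarefreeOf fun p hp => prime_of_mem_sievePrimes hp).mp (ht k)).1.ne_zero
  -- Step 1: each tuple term as a sum over `Y`
  have hstep1 : ∀ t ∈ T,
      (∏ k, ((sieveWt ψ R (t k) : ℝ) : ℂ)) *
          ((crtDensity h₁ h₂ (tupleModulus d t 0) (tupleModulus d t 1) : ℝ) : ℂ)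
        = ∑ Y ∈ (Finset.univ : Finset (Fin 4)).powerset,
            (-1) ^ #Y * (((c t : ℝ) : ℂ) * ∫ τ : Fin 4 → ℝ, slotPower R Y t τ * padWeight ψ Y τ) := by
    intro t ht
    have ht0 := hTpos t ht
    -- `∏ λ = (∏ μ) ∏ (1 - I)`
    have hlam : ∏ k, ((sieveWt ψ R (t k) : ℝ) : ℂ) =
        (∏ k, ((μ (t k) : ℝ) : ℂ)) * ∏ k, (1 - I (t k)) := by
      rw [← Finset.prod_mul_distrib]
      refine Finset.prod_congr rfl fun k _ => ?_
      rw [sieveWt]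
      push_cast
      rw [cutoffLE_eq_one_sub_integral hψ hR (ht0 k)]
    -- `∏ (1 - I) = ∑_Y (-1)^{|Y|} ∏_{k ∈ Y} I`
    have hexpand : ∏ k : Fin 4, (1 - I (t k)) =
        ∑ Y ∈ (Finset.univ : Finset (Fin 4)).powerset, (-1) ^ #Y * ∏ k ∈ Y, I (t k) := by
      have : ∏ k : Fin 4, (1 - I (t k)) = ∏ k : Fin 4, (-I (t k) + 1) :=
        Finset.prod_congr rfl fun k _ => by ring
      rw [this, Finset.prod_add]
      refine Finset.sum_congr rfl fun Y _ => ?_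
      rw [Finset.prod_const_one, mul_one, Finset.prod_neg]
    -- `∏_{k ∈ Y} I = ∫_{ℝ⁴} slotPower · padWeight`
    have hfubini : ∀ Y : Finset (Fin 4),
        ∏ k ∈ Y, I (t k) = ∫ τ : Fin 4 → ℝ, slotPower R Y t τ * padWeight ψ Y τ := by
      intro Y
      have h1 : ∏ k ∈ Y, I (t k) = ∏ k : Fin 4, ∫ x, slotWeight ψ R Y k (t k) x := by
        rw [← Finset.prod_filter_mul_prod_filter_not Finset.univ (fun k => k ∈ Y)]
        have hY : Finset.univ.filter (fun k : Fin 4 => k ∈ Y) = Y := by ext k; simp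
        rw [hY]
        have h2 : ∏ k ∈ Finset.univ.filter (fun k : Fin 4 => ¬ k ∈ Y),
            ∫ x, slotWeight ψ R Y k (t k) x = 1 :=
          Finset.prod_eq_one fun k hk => by
            rw [Finset.mem_filter] at hk
            rw [integral_slotWeight, if_neg hk.2]
        rw [h2, mul_one]
        exact Finset.prod_congr rfl fun k hk => by rw [integral_slotWeight, if_pos hk]
      rw [h1, ← integral_fintype_prod_volume_eq_prod]
      exact integral_congr_ae (Filter.Eventually.of_forall fun τ => prod_slotWeight_eq ψ R Y t τ)
    calc (∏ k, ((sieveWt ψ R (t k) : ℝ) : ℂ)) *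
          ((crtDensity h₁ h₂ (tupleModulus d t 0) (tupleModulus d t 1) : ℝ) : ℂ)
        = ((c t : ℝ) : ℂ) * ∏ k, (1 - I (t k)) := by
          rw [hc, hlam]
          push_cast
          ring
      _ = ((c t : ℝ) : ℂ) * ∑ Y ∈ (Finset.univ : Finset (Fin 4)).powerset,
            (-1) ^ #Y * ∫ τ : Fin 4 → ℝ, slotPower R Y t τ * padWeight ψ Y τ := by
          rw [hexpand]
          congr 1
          exact Finset.sum_congr rfl fun Y _ => by rw [hfubini Y]
      _ = _ := by
          rw [Finset.mul_sum]
          exact Finset.sum_congr rfl fun Y _ => by ring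
  rw [Finset.sum_congr rfl hstep1, Finset.sum_comm]
  refine Finset.sum_congr rfl fun Y _ => ?_
  rw [← Finset.mul_sum]
  congr 1
  -- Step 2: exchange the tuple sum and the `ℝ⁴`-integral
  have hint : ∀ t ∈ T, Integrable (fun τ : Fin 4 → ℝ =>
      ((c t : ℝ) : ℂ) * (slotPower R Y t τ * padWeight ψ Y τ)) := by
    intro t ht
    refine Integrable.const_mul ?_ _
    have h : Integrable (fun τ : Fin 4 → ℝ => ∏ k, slotWeight ψ R Y k (t k) (τ k))
        (Measure.pi fun _ : Fin 4 => (volume : Measure ℝ)) :=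
      Integrable.fintype_prod fun k => integrable_slotWeight hψ R Y k (hTpos t ht k)
    rw [← volume_pi] at h
    refine h.congr (Filter.Eventually.of_forall fun τ => ?_)
    exact prod_slotWeight_eq ψ R Y t τ
  calc ∑ t ∈ T, ((c t : ℝ) : ℂ) * ∫ τ : Fin 4 → ℝ, slotPower R Y t τ * padWeight ψ Y τ
      = ∑ t ∈ T, ∫ τ : Fin 4 → ℝ, ((c t : ℝ) : ℂ) * (slotPower R Y t τ * padWeight ψ Y τ) :=
        Finset.sum_congr rfl fun t _ => (integral_const_mul _ _).symm
    _ = ∫ τ : Fin 4 → ℝ, ∑ t ∈ T, ((c t : ℝ) : ℂ) * (slotPower R Y t τ * padWeight ψ Y τ) :=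
        (integral_finsetSum T hint).symm
    _ = ∫ τ : Fin 4 → ℝ, sieveKernel R h₁ h₂ d Y τ * padWeight ψ Y τ := by
        refine integral_congr_ae (Filter.Eventually.of_forall fun τ => ?_)
        simp only [sieveKernel, hc, Finset.sum_mul]
        exact Finset.sum_congr rfl fun t _ => by ring

end TaoTeravainen

end Literature.Barriers.Parity
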